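import Summits.QuantumAdvantage.QuantumAdvantage.Theorems.RandomOracleGaugeDecoupledCoreAAStubDerivativeFamily
import Summits.QuantumAdvantage.QuantumAdvantage.Theorems.SosSandwichPseudoBoundedAAOfDecoupledCore
import HarnessLib

/-!
# Crux `DecoupledCoreAA` (stmt-QuantumAdvantage-17872), line `l1-family`: the registered stub `stub_l1Family` is
# EQUIVALENT to the crux (and to `AAConj`) — the line is loss-free, in kernel

The skeleton `Cruxes/AAConj/Lines/l1_family.lean` proves `stub_derivativeFamily ∧ stub_l1Family → DecoupledCoreAA`;
`stub_derivativeFamily` is landed (`…StubDerivativeFamily`).  This file proves the CONVERSE and closes the circle: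

* §1 `decoupledCoreAA_of_l1Family` — the skeleton's composition re-proved in `Theorems/` against the landed
  bookkeeping stub (so it is importable): the ℓ¹-family dichotomy gives the crux decl BY NAME.
* §2 `l1Family_of_decoupledCoreAA` — **the converse**: from an ℓ¹-bounded family `g_1..g_N` of degree `≤ d` build the
  one-block-decoupled `q(y,z) = 1/2 + (1/2)Σ_i (±1)^{y_i} g_i(z) ∈ ℝ[Fin (N+N)]` (`[0,1]`-bounded, degree `≤ d+1`,
  `Var q = V/4`, `Inf_{y_i} q = E[g_i²]`, `Inf_{z_j} q = (1/4)Σ_i E[(g_i − g_i^{⊕j})²]` by `stub_derivativeFamily`); an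
  influential variable of `q` is a heavy member (a `y_i`) or a heavy coordinate (a `z_j`).  Constants: regime
  `(κ₀, K₀) ↦ (κ₀, 4K₀)`, `(c, C) ↦ (c, C/2^c)` (`(d+1)^c ≤ (2d)^c`).
* §3 `l1Family_iff_decoupledCoreAA`; `decoupledCoreAA_of_aaConj` (the core is a special case of `AAConj`, re-proved
  from the strategist sketch), `aaConj_iff_decoupledCoreAA`, `aaConj_iff_l1Family` (with the tree's
  `AAConj_of_decoupledCore`), and `pseudoBoundedAA_of_l1Family` (with `pseudoBoundedAA_of_decoupledCore`): the ONE
  registered open stub of the split is exactly AA-strength — neither a strengthening that could be false while the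
  conjecture holds, nor a weakening.

Statements are spelled VERBATIM as registered (`stub_l1Family` of `Lines/l1_family.lean`; the crux decls by name).
Honest label: equivalences/reductions only; the stub, the cruxes `DecoupledCoreAA`/`AAConj`/`PseudoBoundedAA` and the
summit stay open.  Sources: O'Donnell–Zhao arXiv:1512.01603 eqn. (2.1), Thm. 2.13; Aaronson–Ambainis
arXiv:0911.0996 Conj. 6.
-/

-- D-0017: single-conjunct summit ⇒ the duplicate `QuantumAdvantage.QuantumAdvantage` is mandated.
set_option linter.dupNamespace false

noncomputable section

open Finset
open Literature.Computability.QuantumComplexity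
open Summit.QuantumAdvantage.QuantumAdvantage.Theses.RandomOracleGauge (DecoupledCoreAA AAConj)
open Summit.QuantumAdvantage.QuantumAdvantage.Theses.SosSandwich (PseudoBoundedAA)

namespace Summit.QuantumAdvantage.QuantumAdvantage.Cruxes.DecoupledCoreAA.L1Family.Equiv

/-! ### §1 Stub ⟹ crux (the skeleton's composition, against the landed bookkeeping stub) -/

/-- **`stub_l1Family → DecoupledCoreAA`.**  The composition `DecoupledCoreAA_of` of `Lines/l1_family.lean` with its
first hypothesis discharged by the landed `stub_derivativeFamily`: realise the `g_i` of a decoupled `q` as polynomials,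
feed the dichotomy, read a heavy member as a heavy `y`-variable (`Inf_{y_i} = 4E[g_i²]`) and a heavy coordinate as a
heavy `z`-variable. [cite: ODonnellZhao2016, eqn. (2.1)] -/
theorem decoupledCoreAA_of_l1Family
    (hCore : ∀ (κ₀ : ℕ) (K₀ : ℝ), 0 < K₀ → ∃ (c : ℕ) (C : ℝ), 0 < C ∧
      ∀ (N d : ℕ) (g : Fin N → MvPolynomial (Fin N) ℝ), 1 ≤ d → (∀ i, (g i).totalDegree ≤ d) →
        (∀ z, ∑ i, |evalBool (g i) z| ≤ 1) →
        1 ≤ K₀ * (d : ℝ) ^ κ₀ * ∑ i, boolAvg (fun z => evalBool (g i) z ^ 2) →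
        (∃ i, C / (d : ℝ) ^ c ≤ boolAvg (fun z => evalBool (g i) z ^ 2)) ∨
        (∃ j, C / (d : ℝ) ^ c ≤
          ∑ i, boolAvg (fun z => (evalBool (g i) z - evalBool (g i) (flipBit j z)) ^ 2))) :
    DecoupledCoreAA := by
  -- adapted from `Cruxes/AAConj/Lines/l1_family.lean`, `DecoupledCoreAA_of`
  intro κ₀ K₀ hK₀
  obtain ⟨c, C, hC, hX⟩ := hCore κ₀ K₀ hK₀
  refine ⟨c, C, hC, ?_⟩
  intro N d q hdec hd hdeg hb hreg
  obtain ⟨c₀, g, hg⟩ := hdec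
  obtain ⟨hl1, hinfy, hinfz, hvar, hpoly⟩ := stub_derivativeFamily N d q c₀ g hg hdeg hb
  choose r hrdeg hrev using hpoly
  have hsq : ∀ i, boolAvg (fun z => evalBool (r i) z ^ 2) = boolAvg (fun z => g i z ^ 2) := by
    intro i
    simp_rw [hrev i]
  have hdf : ∀ j i, boolAvg (fun z => (evalBool (r i) z - evalBool (r i) (flipBit j z)) ^ 2)
      = boolAvg (fun z => (g i z - g i (flipBit j z)) ^ 2) := by
    intro j i
    simp_rw [hrev i]
  have hl1' : ∀ z, ∑ i, |evalBool (r i) z| ≤ 1 := by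
    intro z
    simp_rw [hrev]
    linarith [hl1 z]
  have hreg' : 1 ≤ K₀ * (d : ℝ) ^ κ₀ * ∑ i, boolAvg (fun z => evalBool (r i) z ^ 2) := by
    simp_rw [hsq, ← hvar]
    exact hreg
  rcases hX N d r hd hrdeg hl1' hreg' with ⟨i, hi⟩ | ⟨j, hj⟩
  · refine ⟨Fin.castAdd N i, ?_⟩
    rw [hinfy i, ← hsq i]
    have h0 : 0 ≤ boolAvg (fun z => evalBool (r i) z ^ 2) := boolAvg_nonneg fun _ => sq_nonneg _
    linarith
  · refine ⟨Fin.natAdd N j, ?_⟩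
    rw [hinfz j]
    simp_rw [← hdf j]
    exact hj

/-! ### §2 Crux ⟹ stub: the decoupled polynomial of an ℓ¹-family -/

variable {N : ℕ}

/-- Cube values of the decoupled polynomial `1/2 + Σ_i (x_{y_i} − 1/2)·g_i(z)` built from a family `g`:
`q(y,z) = 1/2 + Σ_i (±1)^{y_i} · (g_i(z)/2)`. [cite: ODonnellZhao2016, eqn. (2.1)] -/
theorem evalBool_decoupledOf (g : Fin N → MvPolynomial (Fin N) ℝ) (y z : Fin N → Bool) :
    evalBool (MvPolynomial.C (1 / 2 : ℝ) +
        ∑ i, (MvPolynomial.X (Fin.castAdd N i) - MvPolynomial.C (1 / 2 : ℝ)) *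
          MvPolynomial.rename (Fin.natAdd N) (g i)) (Fin.append y z) =
      1 / 2 + ∑ i, (if y i then (1 : ℝ) else -1) * (1 / 2 * evalBool (g i) z) := by
  unfold evalBool
  rw [map_add, MvPolynomial.eval_C, map_sum]
  congr 1
  refine Finset.sum_congr rfl fun i _ => ?_
  rw [map_mul, map_sub, MvPolynomial.eval_X, MvPolynomial.eval_C, MvPolynomial.eval_rename]
  have hcomp : ((fun k : Fin (N + N) => if Fin.append y z k then (1 : ℝ) else 0) ∘ Fin.natAdd N) =
      fun k => if z k then (1 : ℝ) else 0 := by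
    funext k
    simp only [Function.comp_apply, Fin.append_right]
  rw [hcomp, Fin.append_left]
  by_cases hy : y i = true
  · simp only [hy, ↓reduceIte]
    ring
  · simp only [hy, ↓reduceIte, Bool.false_eq_true]
    ring

/-- The decoupled polynomial of a family of degree `≤ d` has total degree `≤ d + 1`. [folklore] -/
theorem totalDegree_decoupledOf_le (g : Fin N → MvPolynomial (Fin N) ℝ) {d : ℕ}
    (hdeg : ∀ i, (g i).totalDegree ≤ d) :
    (MvPolynomial.C (1 / 2 : ℝ) +
        ∑ i, (MvPolynomial.X (Fin.castAdd N i) - MvPolynomial.C (1 / 2 : ℝ)) *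
          MvPolynomial.rename (Fin.natAdd N) (g i)).totalDegree ≤ d + 1 := by
  refine (MvPolynomial.totalDegree_add _ _).trans (max_le ?_ ?_)
  · rw [MvPolynomial.totalDegree_C]; exact Nat.zero_le _
  refine (MvPolynomial.totalDegree_finsetSum _ _).trans (Finset.sup_le fun i _ => ?_)
  refine (MvPolynomial.totalDegree_mul _ _).trans ?_
  have h1 : (MvPolynomial.X (Fin.castAdd N i) - MvPolynomial.C (1 / 2 : ℝ) :
      MvPolynomial (Fin (N + N)) ℝ).totalDegree ≤ 1 := by
    refine (MvPolynomial.totalDegree_sub _ _).trans ?_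
    rw [MvPolynomial.totalDegree_X, MvPolynomial.totalDegree_C]
    simp
  have h2 : (MvPolynomial.rename (Fin.natAdd N) (g i)).totalDegree ≤ d :=
    (MvPolynomial.totalDegree_rename_le _ _).trans (hdeg i)
  omega

/-- The decoupled polynomial of an ℓ¹-bounded family (`Σ_i |g_i(z)| ≤ 1`) is `[0,1]`-valued on the cube. [folklore] -/
theorem decoupledOf_bounded (g : Fin N → MvPolynomial (Fin N) ℝ) (hl1 : ∀ z, ∑ i, |evalBool (g i) z| ≤ 1)
    (x : Fin (N + N) → Bool) :
    0 ≤ evalBool (MvPolynomial.C (1 / 2 : ℝ) +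
        ∑ i, (MvPolynomial.X (Fin.castAdd N i) - MvPolynomial.C (1 / 2 : ℝ)) *
          MvPolynomial.rename (Fin.natAdd N) (g i)) x ∧
    evalBool (MvPolynomial.C (1 / 2 : ℝ) +
        ∑ i, (MvPolynomial.X (Fin.castAdd N i) - MvPolynomial.C (1 / 2 : ℝ)) *
          MvPolynomial.rename (Fin.natAdd N) (g i)) x ≤ 1 := by
  rw [← Fin.append_castAdd_natAdd (f := x), evalBool_decoupledOf]
  set y : Fin N → Bool := fun i => x (Fin.castAdd N i)
  set z : Fin N → Bool := fun i => x (Fin.natAdd N i)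
  have habs : |∑ i, (if y i then (1 : ℝ) else -1) * (1 / 2 * evalBool (g i) z)| ≤ 1 / 2 := by
    calc |∑ i, (if y i then (1 : ℝ) else -1) * (1 / 2 * evalBool (g i) z)|
        ≤ ∑ i, |(if y i then (1 : ℝ) else -1) * (1 / 2 * evalBool (g i) z)| := Finset.abs_sum_le_sum_abs _ _
      _ = ∑ i, 1 / 2 * |evalBool (g i) z| := by
          refine Finset.sum_congr rfl fun i _ => ?_
          rw [abs_mul, abs_mul]
          cases y i <;> simp
      _ = 1 / 2 * ∑ i, |evalBool (g i) z| := by rw [Finset.mul_sum]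
      _ ≤ 1 / 2 * 1 := by linarith [hl1 z]
      _ = 1 / 2 := by ring
  constructor
  · linarith [neg_abs_le (∑ i, (if y i then (1 : ℝ) else -1) * (1 / 2 * evalBool (g i) z))]
  · linarith [le_abs_self (∑ i, (if y i then (1 : ℝ) else -1) * (1 / 2 * evalBool (g i) z))]

/-- `boolAvg` of a quarter: `E[(f/2)²] = E[f²]/4`. [folklore] -/
theorem boolAvg_half_sq (f : (Fin N → Bool) → ℝ) :
    boolAvg (fun z => (1 / 2 * f z) ^ 2) = 1 / 4 * boolAvg (fun z => f z ^ 2) := by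
  unfold boolAvg
  rw [mul_div_assoc', Finset.mul_sum]
  congr 1
  refine Finset.sum_congr rfl fun z _ => ?_
  ring

/-- **`DecoupledCoreAA → stub_l1Family` (the converse; the line `l1-family` is loss-free).**  Given the crux and an
ℓ¹-bounded family `g : Fin N → ℝ[x_1..x_N]` of degree `≤ d` in the regime `1 ≤ K₀ d^κ₀ Σ_i E[g_i²]`, the decoupled
polynomial `q = 1/2 + Σ_i (x_{y_i} − 1/2) g_i(z)` on `Fin (N+N)` is `[0,1]`-bounded of degree `≤ d+1` with
`Var q = (1/4)Σ_i E[g_i²]`, so the crux in the regime `(κ₀, 4K₀)` yields a variable of influence `≥ C/(d+1)^c`: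
a `y_i` gives `E[g_i²] = Inf_{y_i} q ≥ (C/2^c)/d^c` (alternative (A)), a `z_j` gives
`Σ_i E[(g_i − g_i^{⊕j})²] = 4·Inf_{z_j} q ≥ (C/2^c)/d^c` (alternative (B)). [cite: ODonnellZhao2016, eqn. (2.1)] -/
theorem l1Family_of_decoupledCoreAA (hDC : DecoupledCoreAA) :
    ∀ (κ₀ : ℕ) (K₀ : ℝ), 0 < K₀ → ∃ (c : ℕ) (C : ℝ), 0 < C ∧
      ∀ (N d : ℕ) (g : Fin N → MvPolynomial (Fin N) ℝ), 1 ≤ d → (∀ i, (g i).totalDegree ≤ d) →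
        (∀ z, ∑ i, |evalBool (g i) z| ≤ 1) →
        1 ≤ K₀ * (d : ℝ) ^ κ₀ * ∑ i, boolAvg (fun z => evalBool (g i) z ^ 2) →
        (∃ i, C / (d : ℝ) ^ c ≤ boolAvg (fun z => evalBool (g i) z ^ 2)) ∨
        (∃ j, C / (d : ℝ) ^ c ≤
          ∑ i, boolAvg (fun z => (evalBool (g i) z - evalBool (g i) (flipBit j z)) ^ 2)) := by
  intro κ₀ K₀ hK₀
  obtain ⟨c, C, hC, hcore⟩ := hDC κ₀ (4 * K₀) (by positivity)
  refine ⟨c, C / 2 ^ c, by positivity, ?_⟩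
  intro N d g hd hdeg hl1 hreg
  -- the decoupled polynomial and its data
  set q : MvPolynomial (Fin (N + N)) ℝ := MvPolynomial.C (1 / 2 : ℝ) +
    ∑ i, (MvPolynomial.X (Fin.castAdd N i) - MvPolynomial.C (1 / 2 : ℝ)) *
      MvPolynomial.rename (Fin.natAdd N) (g i) with hq
  set g' : Fin N → (Fin N → Bool) → ℝ := fun i z => 1 / 2 * evalBool (g i) z with hg'
  have hform : ∀ y z : Fin N → Bool,
      evalBool q (Fin.append y z) = 1 / 2 + ∑ i, (if y i then (1 : ℝ) else -1) * g' i z :=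
    fun y z => evalBool_decoupledOf g y z
  have hqdeg : q.totalDegree ≤ d + 1 := totalDegree_decoupledOf_le g hdeg
  have hqb : ∀ x, 0 ≤ evalBool q x ∧ evalBool q x ≤ 1 := decoupledOf_bounded g hl1
  obtain ⟨-, hinfy, hinfz, hvar, -⟩ := stub_derivativeFamily N (d + 1) q (1 / 2) g' hform hqdeg hqb
  -- masses and influences of the halved family
  have hmass : ∀ i, boolAvg (fun z => g' i z ^ 2) = 1 / 4 * boolAvg (fun z => evalBool (g i) z ^ 2) :=
    fun i => boolAvg_half_sq _
  have hdiff : ∀ j i, boolAvg (fun z => (g' i z - g' i (flipBit j z)) ^ 2) =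
      1 / 4 * boolAvg (fun z => (evalBool (g i) z - evalBool (g i) (flipBit j z)) ^ 2) := by
    intro j i
    have e : (fun z => (g' i z - g' i (flipBit j z)) ^ 2) =
        fun z => (1 / 2 * (evalBool (g i) z - evalBool (g i) (flipBit j z))) ^ 2 := by
      funext z; rw [hg']; ring
    rw [e]
    exact boolAvg_half_sq _
  set V := ∑ i, boolAvg (fun z => evalBool (g i) z ^ 2) with hV
  have hvarV : boolVariance q = 1 / 4 * V := by
    rw [hvar, hV, Finset.mul_sum]
    exact Finset.sum_congr rfl fun i _ => hmass i
  -- the regime of `q` at degree `d + 1`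
  have hd1 : 1 ≤ d + 1 := Nat.le_add_left 1 d
  have hd0 : (0 : ℝ) < (d : ℝ) := by exact_mod_cast hd
  have hV0 : 0 ≤ V := Finset.sum_nonneg fun i _ => boolAvg_nonneg fun _ => sq_nonneg _
  have hpow : (d : ℝ) ^ κ₀ ≤ ((d + 1 : ℕ) : ℝ) ^ κ₀ := by
    apply pow_le_pow_left₀ hd0.le
    push_cast
    linarith
  have hreg' : 1 ≤ 4 * K₀ * ((d + 1 : ℕ) : ℝ) ^ κ₀ * boolVariance q := by
    rw [hvarV]
    have : K₀ * (d : ℝ) ^ κ₀ * V ≤ K₀ * ((d + 1 : ℕ) : ℝ) ^ κ₀ * V := by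
      apply mul_le_mul_of_nonneg_right _ hV0
      exact mul_le_mul_of_nonneg_left hpow hK₀.le
    nlinarith
  obtain ⟨j, hj⟩ := hcore N (d + 1) q ⟨1 / 2, g', hform⟩ hd1 hqdeg hqb hreg'
  -- `C/(d+1)^c ≥ (C/2^c)/d^c`
  have hd1' : (1 : ℝ) ≤ (d : ℝ) := by exact_mod_cast hd
  have hcmp : C / 2 ^ c / (d : ℝ) ^ c ≤ C / ((d + 1 : ℕ) : ℝ) ^ c := by
    rw [div_div, ← mul_pow]
    apply div_le_div_of_nonneg_left hC.le (by positivity)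
    apply pow_le_pow_left₀ (by positivity)
    push_cast
    linarith
  -- case split on the influential variable of `q`
  revert hj
  refine Fin.addCases (fun i => ?_) (fun j' => ?_) j
  · intro hj
    left
    refine ⟨i, ?_⟩
    rw [hinfy i, hmass i] at hj
    linarith
  · intro hj
    right
    refine ⟨j', ?_⟩
    rw [hinfz j'] at hj
    simp_rw [hdiff j'] at hj
    rw [← Finset.mul_sum] at hj
    have h0 : 0 ≤ ∑ i, boolAvg (fun z => (evalBool (g i) z - evalBool (g i) (flipBit j' z)) ^ 2) :=
      Finset.sum_nonneg fun i _ => boolAvg_nonneg fun _ => sq_nonneg _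
    linarith

/-! ### §3 The circle of equivalences -/

/-- **`stub_l1Family ↔ DecoupledCoreAA`**: the registered open stub is exactly crux-strength.
[cite: ODonnellZhao2016, eqn. (2.1) and Thm. 2.13] -/
theorem l1Family_iff_decoupledCoreAA :
    (∀ (κ₀ : ℕ) (K₀ : ℝ), 0 < K₀ → ∃ (c : ℕ) (C : ℝ), 0 < C ∧
      ∀ (N d : ℕ) (g : Fin N → MvPolynomial (Fin N) ℝ), 1 ≤ d → (∀ i, (g i).totalDegree ≤ d) →
        (∀ z, ∑ i, |evalBool (g i) z| ≤ 1) →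
        1 ≤ K₀ * (d : ℝ) ^ κ₀ * ∑ i, boolAvg (fun z => evalBool (g i) z ^ 2) →
        (∃ i, C / (d : ℝ) ^ c ≤ boolAvg (fun z => evalBool (g i) z ^ 2)) ∨
        (∃ j, C / (d : ℝ) ^ c ≤
          ∑ i, boolAvg (fun z => (evalBool (g i) z - evalBool (g i) (flipBit j z)) ^ 2))) ↔
    DecoupledCoreAA :=
  ⟨decoupledCoreAA_of_l1Family, l1Family_of_decoupledCoreAA⟩

/-- `AAConj → DecoupledCoreAA`: the core is the special case of decoupled polynomials at variance
`ε = 1/(K₀ d^κ₀)`. [cite: AaronsonAmbainis2014, Conj. 6] -/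
theorem decoupledCoreAA_of_aaConj (h : AAConj) : DecoupledCoreAA := by
  -- adapted from `Cruxes/AAConj/StrategistSketch.lean`, `decoupledCoreAA_of_AAConj`
  intro κ₀ K₀ hK₀
  obtain ⟨c, C, hC, hAA⟩ := h
  refine ⟨c * (κ₀ + 1), C / K₀ ^ c, by positivity, ?_⟩
  intro N d q _hdec hd hdeg hb hreg
  have hd1 : (1 : ℝ) ≤ d := by exact_mod_cast hd
  have hpos : 0 < K₀ * (d : ℝ) ^ κ₀ := by positivity
  have hε : 1 / (K₀ * (d : ℝ) ^ κ₀) ≤ boolVariance q := by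
    rw [div_le_iff₀ hpos]; linarith
  obtain ⟨j, hj⟩ := hAA (N + N) d q (1 / (K₀ * (d : ℝ) ^ κ₀)) hd hdeg hb (by positivity) hε
  refine ⟨j, le_trans (le_of_eq ?_) hj⟩
  have hd0 : (0 : ℝ) < d := by linarith
  have e1 : (1 / (K₀ * (d : ℝ) ^ κ₀) / (d : ℝ)) ^ c = 1 / (K₀ ^ c * ((d : ℝ) ^ (c * κ₀) * (d : ℝ) ^ c)) := by
    rw [div_div, div_pow, one_pow, mul_pow, mul_pow, ← pow_mul, mul_comm κ₀ c, mul_assoc]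
  have e2 : (d : ℝ) ^ (c * (κ₀ + 1)) = (d : ℝ) ^ (c * κ₀) * (d : ℝ) ^ c := by
    rw [show c * (κ₀ + 1) = c * κ₀ + c by ring, pow_add]
  rw [e1, e2]
  field_simp

/-- **`AAConj ↔ DecoupledCoreAA`** (with the tree's `AAConj_of_decoupledCore`: one-block decoupling + variance
amplification, both proved). [cite: ODonnellZhao2016, Thm. 2.13] -/
theorem aaConj_iff_decoupledCoreAA : AAConj ↔ DecoupledCoreAA :=
  ⟨decoupledCoreAA_of_aaConj, Summit.QuantumAdvantage.QuantumAdvantage.Theorems.RandomOracleGauge.AAConj_of_decoupledCore⟩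

/-- **`AAConj ↔ stub_l1Family`**: the Aaronson–Ambainis conjecture (route decl `AAConj`) is equivalent to the
ℓ¹-family dichotomy as registered. [cite: ODonnellZhao2016, Thm. 2.13] [cite: AaronsonAmbainis2014, Conj. 6] -/
theorem aaConj_iff_l1Family :
    AAConj ↔
    (∀ (κ₀ : ℕ) (K₀ : ℝ), 0 < K₀ → ∃ (c : ℕ) (C : ℝ), 0 < C ∧
      ∀ (N d : ℕ) (g : Fin N → MvPolynomial (Fin N) ℝ), 1 ≤ d → (∀ i, (g i).totalDegree ≤ d) →
        (∀ z, ∑ i, |evalBool (g i) z| ≤ 1) →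
        1 ≤ K₀ * (d : ℝ) ^ κ₀ * ∑ i, boolAvg (fun z => evalBool (g i) z ^ 2) →
        (∃ i, C / (d : ℝ) ^ c ≤ boolAvg (fun z => evalBool (g i) z ^ 2)) ∨
        (∃ j, C / (d : ℝ) ^ c ≤
          ∑ i, boolAvg (fun z => (evalBool (g i) z - evalBool (g i) (flipBit j z)) ^ 2))) :=
  aaConj_iff_decoupledCoreAA.trans l1Family_iff_decoupledCoreAA.symm

/-- **`stub_l1Family → PseudoBoundedAA`** (route `SosSandwich`, stmt-QuantumAdvantage-15237, by name): closing the
registered stub closes the SOS-sandwich crux, via `pseudoBoundedAA_of_decoupledCore`.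
[cite: ODonnellZhao2016, Thm. 2.13] [cite: AaronsonAmbainis2014, Conj. 6] -/
theorem pseudoBoundedAA_of_l1Family
    (hCore : ∀ (κ₀ : ℕ) (K₀ : ℝ), 0 < K₀ → ∃ (c : ℕ) (C : ℝ), 0 < C ∧
      ∀ (N d : ℕ) (g : Fin N → MvPolynomial (Fin N) ℝ), 1 ≤ d → (∀ i, (g i).totalDegree ≤ d) →
        (∀ z, ∑ i, |evalBool (g i) z| ≤ 1) →
        1 ≤ K₀ * (d : ℝ) ^ κ₀ * ∑ i, boolAvg (fun z => evalBool (g i) z ^ 2) →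
        (∃ i, C / (d : ℝ) ^ c ≤ boolAvg (fun z => evalBool (g i) z ^ 2)) ∨
        (∃ j, C / (d : ℝ) ^ c ≤
          ∑ i, boolAvg (fun z => (evalBool (g i) z - evalBool (g i) (flipBit j z)) ^ 2))) :
    PseudoBoundedAA :=
  Summit.QuantumAdvantage.QuantumAdvantage.Theorems.SosSandwich.pseudoBoundedAA_of_decoupledCore
    (decoupledCoreAA_of_l1Family hCore)

end Summit.QuantumAdvantage.QuantumAdvantage.Cruxes.DecoupledCoreAA.L1Family.Equiv

end
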